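import Literature.MathematicalPhysics.QuantumLattice.IsingAnisotropicAntiferromagnetLongRangeOrder
import Literature.MathematicalPhysics.QuantumLattice.AntiferromagnetChessboardEstimate
import HarnessLib

/-!
# Néel order of the Ising-anisotropic XXZ antiferromagnet in its physical frame
# (Fröhlich–Lieb 1978, §I.A model (3), §I.B (3), §IV (c))

Topic `MathematicalPhysics/QuantumLattice`; companion of
`IsingAnisotropicAntiferromagnetLongRangeOrder.lean`. That file proves Fröhlich–Lieb's long-range
order for the quantum antiferromagnet (3), `H = S⁻²[Hᶻ + αHˣʸ]` (1.3), in the ROTATED real frame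
(1.4a) — tree `xyzRealFieldHamiltonian L n α (-α) 0 = -Σ_{⟨xy⟩}(αS¹S¹ - αS²S² + S³S³)` (`= S²·H`
of (1.4a)) — where the order observable is the plain sign `σ_x = P⁺_x - P⁻_x = sgn⁺ S³_x` at every
site. FL §I.A (3): "This is obtained by making a rotation of `π` about the y-axis for the spins on
one of the two sublattices; for such spin operators `Sᶻ → -Sᶻ`, `Sˣ → -Sˣ`, `Sʸ → +Sʸ`"; §I.B (3):
the order parameter of model (3) is the STAGGERED magnetisation `m_i = S⁻¹(-1)^{i₁+i₂}Sᶻ_i`. This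
file carries the result back to the PHYSICAL XXZ antiferromagnet of the tree,
`xxzHamiltonian n (torusGraph d L) J Δ = J Σ_{⟨xy⟩}(SˣSˣ + SʸSʸ + Δ SᶻSᶻ)` with `J > 0` and Ising
anisotropy `Δ = α⁻¹` (FL's (1.3) is `S⁻²α · Σ(SˣSˣ + SʸSʸ + α⁻¹SᶻSᶻ)`, i.e. `J = αS⁻²`):

* §1 `exists_productOp_conj_xxzHamiltonian` — the odd-sublattice half-turn about the `2`-axis as
  an explicit product unitary `U = ⨂_z u_z` (`u_z = 1` on the even, `u_z = R` on the odd
  sublattice, `R S³ Rᴴ = -S³`) with `U H_{J,Δ} Uᴴ = (JΔ) · H♭(Δ⁻¹)`,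
  `H♭(α) = xyzRealFieldHamiltonian L n α (-α) 0` (bond by bond across the bipartite even torus:
  `SˣSˣ ↦ -SˣSˣ`, `SʸSʸ ↦ SʸSʸ`, `SᶻSᶻ ↦ -SᶻSᶻ`), for every `d`, even `L`, `J` and `Δ ≠ 0`;
* §2 `exists_unitary_conj_xxzHamiltonian_neelDiagonal` — the same unitary maps the Néel placement
  `N_x(w)` of a diagonal single-site observable (`diag w` on the even, `diag(w reversed)` on the odd
  sublattice: tree `neelDiagonal`, `P^{+δ} ↔ P^{-δ}` of FL §I.B) to the constant placement
  `diag w`; `xxz_gibbsState_neel_twoPoint_eq` — hence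
  `⟨N_x(w₁) N_y(w₂)⟩_{β, H_{J,Δ}} = ⟨diag w₁ · diag w₂⟩_{βJΔ, H♭(Δ⁻¹)}` (unitary covariance of Gibbs
  states, `e^{-β(cH)} = e^{-(βc)H}`);
* §3 the physical statements. `szNonnegProj_sub_szNegProj`: `σ = P⁺ - P⁻ = diag(sgn⁺(n/2 - k))`;
  **`xxzAF_neelSigma_twoPoint_ge_half`** — on the torus `(ℤ/Nbℤ)²` (`N` even `> 1`, `Nb ≥ 3`), for
  `J > 0`, `Δ > 0`, `β ≥ 0` and the smallness hypotheses of `anisoAF_sigma_twoPoint_ge_half` at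
  `α = Δ⁻¹` and effective inverse temperature `βJΔ`: `Re⟨N_m(σ) N_{n'}(σ)⟩_{β, H_{J,Δ}} ≥ 1/2` for
  all sites `m ≠ n'`, where `N_x(σ) = sgn⁺((-1)^x S³_x)` is the sign of the staggered spin (FL (1.9)
  with `M² = 1/2` for the order parameter (3) of §I.B); `xxzAF_neelSigma_twoPoint_ge_half_explicit`
  — the same on `(ℤ/2Nℤ)²` under the explicit thresholds `Δ ≥ (64 + 2n)/n · (2·10³²⁰)^{32/n}`,
  `βJΔ ≥ 16(log(2·10³²⁰) + 4 log(n+1))/n²` (`n ≥ 1`); **`xxzAF_longRangeOrder_of_one_lt`** — FL's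
  theorem for model (3) as printed in §I.A: for every `J > 0` and every `Δ > 1` there is a spin
  `n₀/2` such that for every spin `n/2 ≥ n₀/2` there is `β₀` with Néel long-range order
  `Re⟨N_m(σ) N_{n'}(σ)⟩ ≥ 1/2` for all `β ≥ β₀`, all even volumes and all pairs of sites ("For each
  `S` there is an `α(S)` and `β_c(α)` such that for `α < α(S)` and `β > β_c(α)` there is LRO. As
  `S → ∞`, `α(S) → 1`").

No named facts; no sorries.

## References

* J. Fröhlich, E. H. Lieb, *Phase transitions in anisotropic lattice spin systems*, Comm. Math.
  Phys. **60** (1978) 233–267; §I.A model (3), eqs. (1.3)–(1.4a); §I.B (3), eqs. (1.8)–(1.9);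
  §IV (c) (Selecta pp. 237–239, 260–263). [FrohlichLieb1978]
* F. J. Dyson, E. H. Lieb, B. Simon, *Phase transitions in quantum spin systems with isotropic and
  nonisotropic interactions*, J. Stat. Phys. **18** (1978) 335–383, §2 (the sublattice rotation).
  [DLS1978]
* T. Kennedy, E. H. Lieb, B. S. Shastry, J. Stat. Phys. **53** (1988) 1019–1030, eqs. (15)–(17).
  [KLS1988JSP]
-/

noncomputable section

open Matrix Finset
open scoped ComplexOrder BigOperators
open Literature.MathematicalPhysics.QuantumLattice Literature.Probability.LatticeModels
  Literature.MathematicalPhysics.QuantumLattice.SpinOperators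

namespace Literature.MathematicalPhysics.QuantumLattice

variable {d : ℕ}

/-! ### §1 The odd-sublattice half-turn of the XXZ Hamiltonian -/

section Rotation

variable (L : ℕ) [NeZero L]

/-- The rotated XXZ bond is `Δ` times the tree's real bond at couplings `(Δ⁻¹, -Δ⁻¹)` and zero
field: `-b⁰ + b¹ - Δb² = Δ·τ_{Δ⁻¹,-Δ⁻¹,0}(x,y)` (`τ_{J₁,J₂,0} = -J₁b⁰ - J₂b¹ - b²`), `Δ ≠ 0`.
[cite: FrohlichLieb1978, eqs. (1.3)–(1.4a)] -/
private theorem ipf_bond_eq {Λ : Type*} [Fintype Λ] [DecidableEq Λ] (n : ℕ) {Δ : ℝ} (hΔ : Δ ≠ 0)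
    (x y : Λ) :
    -spinBond n 0 x y + spinBond n 1 x y + (Δ : ℂ) • -spinBond n 2 x y =
      (Δ : ℂ) • xyzRealBond n Δ⁻¹ (-Δ⁻¹) (0 : Λ → ℝ) x y := by
  have hΔ' : (Δ : ℂ) ≠ 0 := Complex.ofReal_ne_zero.mpr hΔ
  simp only [xyzRealBond, Pi.zero_apply, sub_self, Complex.ofReal_zero, zero_smul, sub_zero,
    zero_pow two_ne_zero, zero_div, add_zero, Complex.ofReal_neg, Complex.ofReal_inv, neg_smul,
    sub_neg_eq_add, smul_add, smul_sub, smul_neg, smul_smul, mul_inv_cancel₀ hΔ', one_smul]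
  abel

/-- **The sublattice half-turn of the XXZ model** (FL §I.A (3): "a rotation of `π` about the
y-axis for the spins on one of the two sublattices; for such spin operators `Sᶻ → -Sᶻ`,
`Sˣ → -Sˣ`, `Sʸ → +Sʸ`"; DLS §2; KLS eqs. (15)–(17)): on the even torus and for every spin `n/2`
there is a single-site unitary `R` with `R S³ Rᴴ = -S³` such that the product unitary
`U = ⨂_z u_z`, `u_z = 1` on the even and `u_z = R` on the odd sublattice, conjugates the physical
XXZ Hamiltonian `J Σ(SˣSˣ + SʸSʸ + Δ SᶻSᶻ)`, `Δ ≠ 0`, into `(JΔ)` times the tree's rotated real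
form at anisotropy `α = Δ⁻¹`: `U H_{J,Δ} Uᴴ = (JΔ) · (-Σ(Δ⁻¹S¹S¹ - Δ⁻¹S²S² + S³S³))` (every edge
of the even torus joins the two sublattices, so `SˣSˣ ↦ -SˣSˣ`, `SʸSʸ ↦ SʸSʸ`, `SᶻSᶻ ↦ -SᶻSᶻ`).
[cite: FrohlichLieb1978, §I.A (3), eqs. (1.3)–(1.4a)] [cite: DLS1978, §2]
[cite: KLS1988JSP, eqs. (15)–(17)] -/
theorem exists_productOp_conj_xxzHamiltonian (hL : Even L) (n : ℕ) :
    ∃ R : Matrix (Fin (n + 1)) (Fin (n + 1)) ℂ, R * Rᴴ = 1 ∧ Rᴴ * R = 1 ∧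
      R * SpinOperators.spinZ n * Rᴴ = -SpinOperators.spinZ n ∧
      ∀ J Δ : ℝ, Δ ≠ 0 →
        productOp (fun z => if torusSiteParity L hL z = 0 then 1 else R) *
            xxzHamiltonian n (torusGraph d L) J Δ *
            (productOp (fun z => if torusSiteParity L hL z = 0 then 1 else R))ᴴ =
          ((J * Δ : ℝ) : ℂ) • xyzRealFieldHamiltonian L n Δ⁻¹ (-Δ⁻¹) 0 := by
  set E := (torusGraph d L).edgeFinset with hE
  -- the single-site rotation `R = V²` (`π` about the `2`-axis): `Sˣ ↦ -Sˣ`, `Sʸ ↦ Sʸ`, `Sᶻ ↦ -Sᶻ`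
  obtain ⟨V, hV, hV', hVz, hVx, hVy⟩ := exists_unitary_conj_spinZ_eq_spinX n
  set R := V * V with hR
  have hRR : R * Rᴴ = 1 := by
    rw [hR, conjTranspose_mul, Matrix.mul_assoc, ← Matrix.mul_assoc V Vᴴ, hV, Matrix.one_mul, hV]
  have hRR' : Rᴴ * R = 1 := by
    rw [hR, conjTranspose_mul, Matrix.mul_assoc, ← Matrix.mul_assoc Vᴴ V, hV', Matrix.one_mul, hV']
  have hRz : R * SpinOperators.spinZ n * Rᴴ = -SpinOperators.spinZ n := by
    rw [hR, conjTranspose_mul, show V * V * SpinOperators.spinZ n * (Vᴴ * Vᴴ) =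
      V * (V * SpinOperators.spinZ n * Vᴴ) * Vᴴ by simp only [Matrix.mul_assoc], hVz, hVx]
  have hRy : R * spinY n * Rᴴ = spinY n := by
    rw [hR, conjTranspose_mul, show V * V * spinY n * (Vᴴ * Vᴴ) =
      V * (V * spinY n * Vᴴ) * Vᴴ by simp only [Matrix.mul_assoc], hVy, hVy]
  have hRx : R * spinX n * Rᴴ = -spinX n := by
    rw [hR, conjTranspose_mul, show V * V * spinX n * (Vᴴ * Vᴴ) =
      V * (V * spinX n * Vᴴ) * Vᴴ by simp only [Matrix.mul_assoc], hVx, Matrix.mul_neg,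
      Matrix.neg_mul, hVz]
  refine ⟨R, hRR, hRR', hRz, fun J Δ hΔ => ?_⟩
  -- the product unitary on the odd sublattice
  set ε : TorusSite d L → ZMod 2 := torusSiteParity L hL with hε
  set u : TorusSite d L → Matrix (Fin (n + 1)) (Fin (n + 1)) ℂ :=
    fun z => if ε z = 0 then 1 else R with hu
  have hua : ∀ z, u z * (u z)ᴴ = 1 := by
    intro z; simp only [hu]; split_ifs
    · rw [conjTranspose_one, Matrix.mul_one]
    · exact hRR
  have hub : ∀ z, (u z)ᴴ * u z = 1 := by
    intro z; simp only [hu]; split_ifs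
    · rw [conjTranspose_one, Matrix.mul_one]
    · exact hRR'
  set sgn : TorusSite d L → ℂ := fun z => if ε z = 0 then 1 else -1 with hsgn
  have hux : ∀ z, u z * spinX n * (u z)ᴴ = sgn z • spinX n := by
    intro z; simp only [hu, hsgn]; split_ifs
    · rw [conjTranspose_one, Matrix.mul_one, Matrix.one_mul, one_smul]
    · rw [hRx, neg_one_smul]
  have huy : ∀ z, u z * spinY n * (u z)ᴴ = spinY n := by
    intro z; simp only [hu]; split_ifs
    · rw [conjTranspose_one, Matrix.mul_one, Matrix.one_mul]
    · exact hRy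
  have huz : ∀ z, u z * SpinOperators.spinZ n * (u z)ᴴ = sgn z • SpinOperators.spinZ n := by
    intro z; simp only [hu, hsgn]; split_ifs
    · rw [conjTranspose_one, Matrix.mul_one, Matrix.one_mul, one_smul]
    · rw [hRz, neg_one_smul]
  -- every edge of the even torus joins the two sublattices
  have hedge : ∀ e ∈ E, ∀ x y, e = s(x, y) → sgn x * sgn y = -1 := by
    intro e he x y hexy
    subst hexy
    rw [hE, SimpleGraph.mem_edgeFinset, SimpleGraph.mem_edgeSet, torusGraph_adj_iff] at he
    have h01 : ∀ t : ZMod 2, t = 0 ∨ t = 1 := by decide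
    have key : ∀ x' : TorusSite d L, ∀ i, sgn x' * sgn (x' + Pi.single i 1) = -1 := by
      intro x' i
      have hpar : ε (x' + Pi.single i 1) = ε x' + 1 := torusSiteParity_add_single L hL x' i
      simp only [hsgn, hpar]
      rcases h01 (ε x') with h0 | h1
      · rw [if_pos h0, if_neg (by rw [h0]; decide), one_mul]
      · rw [if_neg (by rw [h1]; decide), if_pos (by rw [h1]; decide), mul_one]
    obtain ⟨-, ⟨i, rfl⟩ | ⟨i, rfl⟩⟩ := he
    · exact key x i
    · rw [mul_comm]; exact key y i
  set W := productOp u with hW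
  -- conjugation of the three bond operators
  have hb0 : ∀ x y : TorusSite d L, sgn x * sgn y = -1 →
      W * spinBond n 0 x y * Wᴴ = -spinBond n 0 x y := by
    intro x y hxy
    rw [hW, productOp_conj_spinBond hua hub, spinVec_zero, hux, hux, onSite_smul', onSite_smul',
      smul_mul_smul_comm, smul_mul_smul_comm, mul_comm (sgn y) (sgn x), hxy, spinBond]
    simp only [neg_smul, one_smul]
    rw [← neg_add, smul_neg]
    rfl
  have hb1 : ∀ x y : TorusSite d L, W * spinBond n 1 x y * Wᴴ = spinBond n 1 x y := by
    intro x y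
    rw [hW, productOp_conj_spinBond hua hub, spinVec_one, huy, huy, spinBond]
    rfl
  have hb2 : ∀ x y : TorusSite d L, sgn x * sgn y = -1 →
      W * spinBond n 2 x y * Wᴴ = -spinBond n 2 x y := by
    intro x y hxy
    rw [hW, productOp_conj_spinBond hua hub, spinVec_two, huz, huz, onSite_smul', onSite_smul',
      smul_mul_smul_comm, smul_mul_smul_comm, mul_comm (sgn y) (sgn x), hxy, spinBond]
    simp only [neg_smul, one_smul]
    rw [← neg_add, smul_neg]
    rfl
  -- bond by bond
  have hbond : ∀ e ∈ E,
      W * Sym2.lift ⟨fun x y => spinBond n 0 x y + spinBond n 1 x y + (Δ : ℂ) • spinBond n 2 x y,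
          fun x y => by simp only [spinBond_comm]⟩ e * Wᴴ =
        (Δ : ℂ) • Sym2.lift ⟨fun x y => xyzRealBond n Δ⁻¹ (-Δ⁻¹) 0 x y,
          fun _ _ => xyzRealBond_comm n Δ⁻¹ (-Δ⁻¹) 0 _ _⟩ e := by
    intro e he
    induction e using Sym2.ind with
    | h x y =>
      have hs := hedge _ he x y rfl
      simp only [Sym2.lift_mk, Matrix.mul_add, Matrix.add_mul, Matrix.mul_smul, Matrix.smul_mul,
        hb0 x y hs, hb1, hb2 x y hs]
      exact ipf_bond_eq n hΔ x y
  rw [xxzHamiltonian, xyzRealFieldHamiltonian, Matrix.mul_smul, Matrix.smul_mul, Finset.mul_sum,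
    Finset.sum_mul, Complex.ofReal_mul, mul_smul]
  congr 1
  rw [Finset.smul_sum]
  exact Finset.sum_congr rfl hbond

/-! ### §2 The half-turn on Néel-placed diagonal observables and on Gibbs states -/

/-- **The half-turn straightens the Néel placement.** The unitary of
`exists_productOp_conj_xxzHamiltonian`, packaged: a unitary `U` on the even torus with
`U H_{J,Δ} Uᴴ = (JΔ)·H♭(Δ⁻¹)` for all `J` and `Δ ≠ 0`, and `U N_x(w) Uᴴ = diag(w)_x` for every
diagonal single-site weight `w` and every site `x`, where `N_x(w)` (`neelDiagonal`) is `diag w` on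
the even and `diag(w reversed)` on the odd sublattice (`R diag(w') Rᴴ = diag(w' reversed)` for
`R S³ Rᴴ = -S³`, FL §I.B: `P^{+δ} ↔ P^{-δ}`). [cite: FrohlichLieb1978, §I.A (3), §I.B (3)]
[cite: DLS1978, §2] -/
theorem exists_unitary_conj_xxzHamiltonian_neelDiagonal (hL : Even L) (n : ℕ) :
    ∃ U : Op (TorusSite d L) (n + 1), U * Uᴴ = 1 ∧ Uᴴ * U = 1 ∧
      (∀ J Δ : ℝ, Δ ≠ 0 → U * xxzHamiltonian n (torusGraph d L) J Δ * Uᴴ =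
        ((J * Δ : ℝ) : ℂ) • xyzRealFieldHamiltonian L n Δ⁻¹ (-Δ⁻¹) 0) ∧
      ∀ (w : Fin (n + 1) → ℂ) (x : TorusSite d L),
        U * onSite x (neelDiagonal L hL w x) * Uᴴ = onSite x (diagonal w) := by
  obtain ⟨R, hRR, hRR', hRz, hconj⟩ := exists_productOp_conj_xxzHamiltonian (d := d) L hL n
  set u : TorusSite d L → Matrix (Fin (n + 1)) (Fin (n + 1)) ℂ :=
    fun z => if torusSiteParity L hL z = 0 then 1 else R with hu
  have hua : ∀ z, u z * (u z)ᴴ = 1 := by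
    intro z; simp only [hu]; split_ifs
    · rw [conjTranspose_one, Matrix.mul_one]
    · exact hRR
  have hub : ∀ z, (u z)ᴴ * u z = 1 := by
    intro z; simp only [hu]; split_ifs
    · rw [conjTranspose_one, Matrix.mul_one]
    · exact hRR'
  refine ⟨productOp u, productOp_mul_conjTranspose hua, productOp_conjTranspose_mul hub, hconj,
    fun w x => ?_⟩
  rw [productOp_conj_onSite hua]
  congr 1
  simp only [hu]
  by_cases hx : torusSiteParity L hL x = 0
  · rw [if_pos hx, neelDiagonal_of_even L hL w hx, conjTranspose_one, Matrix.mul_one,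
      Matrix.one_mul]
  · rw [if_neg hx, neelDiagonal_of_odd L hL w hx, conj_diagonal_of_conj_spinZ_eq_neg hRR hRR' hRz]
    simp only [Fin.rev_rev]

/-- Unitary covariance of Gibbs states: `⟨Wᴴ B W⟩_{β, Wᴴ X W} = ⟨B⟩_{β,X}` for unitary `W`
(`e^{Wᴴ X W} = Wᴴ e^X W`, cyclicity of the trace; the tree's `Matrix.gibbsState_unitary_conj`,
reproved here to keep the imports light). [cite: BratteliRobinsonII1997, §5.3.1] -/
private theorem ipf_gibbsState_unitary_conj {m : Type*} [Fintype m] [DecidableEq m] (β : ℝ)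
    {W : Matrix m m ℂ} (hWW : Wᴴ * W = 1) (hWW' : W * Wᴴ = 1) (X B : Matrix m m ℂ) :
    Matrix.gibbsState β (Wᴴ * X * W) (Wᴴ * B * W) = Matrix.gibbsState β X B := by
  have hU : IsUnit Wᴴ := ⟨⟨Wᴴ, W, hWW, hWW'⟩, rfl⟩
  have hinv : Wᴴ⁻¹ = W := Matrix.inv_eq_right_inv hWW
  have hexp : gibbsWeight β (Wᴴ * X * W) = Wᴴ * gibbsWeight β X * W := by
    unfold gibbsWeight
    rw [show -(β : ℂ) • (Wᴴ * X * W) = Wᴴ * (-(β : ℂ) • X) * Wᴴ⁻¹ by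
      rw [hinv, Matrix.mul_smul, Matrix.smul_mul], Matrix.exp_conj _ _ hU, hinv]
  have h1 : (Wᴴ * gibbsWeight β X * W).trace = (gibbsWeight β X).trace := by
    rw [Matrix.trace_mul_cycle, hWW', Matrix.one_mul]
  have h2 : (Wᴴ * gibbsWeight β X * W * (Wᴴ * B * W)).trace = (gibbsWeight β X * B).trace := by
    have e : Wᴴ * gibbsWeight β X * W * (Wᴴ * B * W) = Wᴴ * (gibbsWeight β X * B) * W := by
      calc Wᴴ * gibbsWeight β X * W * (Wᴴ * B * W)
          = Wᴴ * gibbsWeight β X * (W * Wᴴ) * B * W := by simp only [Matrix.mul_assoc]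
        _ = Wᴴ * (gibbsWeight β X * B) * W := by rw [hWW', Matrix.mul_one, Matrix.mul_assoc Wᴴ]
    rw [e, Matrix.trace_mul_cycle, hWW', Matrix.one_mul]
  rw [Matrix.gibbsState_apply, Matrix.gibbsState_apply, partitionFn, partitionFn, hexp, h1, h2]

/-- A real rescaling of the Hamiltonian is a rescaling of the inverse temperature:
`⟨A⟩_{β, cH} = ⟨A⟩_{βc, H}` (`e^{-β(cH)} = e^{-(βc)H}`). [cite: BratteliRobinsonII1997, §5.3.1] -/
private theorem ipf_gibbsState_real_smul {m : Type*} [Fintype m] [DecidableEq m] (β c : ℝ)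
    (H A : Matrix m m ℂ) :
    Matrix.gibbsState β ((c : ℂ) • H) A = Matrix.gibbsState (β * c) H A := by
  have hw : gibbsWeight β ((c : ℂ) • H) = gibbsWeight (β * c) H := by
    unfold gibbsWeight
    rw [smul_smul, Complex.ofReal_mul, neg_mul]
  rw [Matrix.gibbsState_apply, Matrix.gibbsState_apply, partitionFn, partitionFn, hw]

/-- **Two-point functions of Néel-placed diagonal observables in the physical frame are two-point
functions of constantly-placed ones in the rotated frame**: for `Δ ≠ 0`, every `β`, all diagonal
weights `w₁, w₂` and all sites `x, y` of the even torus,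
`⟨N_x(w₁) N_y(w₂)⟩_{β, J Σ(SˣSˣ+SʸSʸ+ΔSᶻSᶻ)} = ⟨diag(w₁)_x diag(w₂)_y⟩_{βJΔ, H♭(Δ⁻¹)}`
(`H♭(α) = xyzRealFieldHamiltonian L n α (-α) 0`; unitary covariance of the Gibbs state under the
sublattice half-turn and `e^{-β(cH)} = e^{-(βc)H}`). [cite: FrohlichLieb1978, §I.A (3), §I.B (3)]
[cite: DLS1978, §2] -/
theorem xxz_gibbsState_neel_twoPoint_eq (hL : Even L) (n : ℕ) {J Δ : ℝ} (hΔ : Δ ≠ 0) (β : ℝ)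
    (w₁ w₂ : Fin (n + 1) → ℂ) (x y : TorusSite d L) :
    Matrix.gibbsState β (xxzHamiltonian n (torusGraph d L) J Δ)
        (onSite x (neelDiagonal L hL w₁ x) * onSite y (neelDiagonal L hL w₂ y)) =
      Matrix.gibbsState (β * (J * Δ)) (xyzRealFieldHamiltonian L n Δ⁻¹ (-Δ⁻¹) 0)
        ((onSite x (diagonal w₁) : Op (TorusSite d L) (n + 1)) * onSite y (diagonal w₂)) := by
  obtain ⟨U, hUU, hUU', hH, hN⟩ := exists_unitary_conj_xxzHamiltonian_neelDiagonal (d := d) L hL n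
  have hsandwich : ∀ M : Op (TorusSite d L) (n + 1), Uᴴ * (U * M * Uᴴ) * U = M := fun M => by
    rw [show Uᴴ * (U * M * Uᴴ) * U = Uᴴ * U * M * (Uᴴ * U) by simp only [Matrix.mul_assoc],
      hUU', Matrix.one_mul, Matrix.mul_one]
  have hkey : ∀ A B : Op (TorusSite d L) (n + 1),
      Uᴴ * (U * A * Uᴴ * (U * B * Uᴴ)) * U = A * B := fun A B => by
    calc Uᴴ * (U * A * Uᴴ * (U * B * Uᴴ)) * U
        = Uᴴ * U * A * (Uᴴ * U) * B * (Uᴴ * U) := by simp only [Matrix.mul_assoc]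
      _ = A * B := by rw [hUU', Matrix.one_mul, Matrix.mul_one, Matrix.mul_one]
  have hH' : xxzHamiltonian n (torusGraph d L) J Δ =
      Uᴴ * (((J * Δ : ℝ) : ℂ) • xyzRealFieldHamiltonian L n Δ⁻¹ (-Δ⁻¹) 0) * U := by
    rw [← hH J Δ hΔ, hsandwich]
  rw [hH', ← hkey (onSite x (neelDiagonal L hL w₁ x)) (onSite y (neelDiagonal L hL w₂ y)), hN w₁ x,
    hN w₂ y, ipf_gibbsState_unitary_conj β hUU' hUU, ipf_gibbsState_real_smul]

end Rotation

/-! ### §3 Néel long-range order of the physical XXZ antiferromagnet -/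

/-- The order observable `σ = P⁺ - P⁻` (FL (1.12), `δ → 0`) is the diagonal sign matrix
`diag(sgn⁺(n/2 - k))_k` (`+1` on `S³ ≥ 0`, `-1` on `S³ < 0`). [cite: FrohlichLieb1978, eq. (1.12)] -/
theorem szNonnegProj_sub_szNegProj (n : ℕ) :
    szNonnegProj n - szNegProj n =
      diagonal fun k : Fin (n + 1) => if 2 * (k : ℕ) ≤ n then (1 : ℂ) else -1 := by
  rw [szNonnegProj, szNegProj, diagonal_sub]
  congr 1
  funext k
  split_ifs <;> norm_num

section PhysicalFrame

variable {N b : ℕ} [NeZero N] [NeZero b] (n : ℕ)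

/-- **Néel order of the Ising-anisotropic XXZ antiferromagnet, physical frame** (FL §I.A (3) with
§I.B (3) and §IV (c), via the sublattice half-turn): on the torus `(ℤ/Nbℤ)²` (`N` even, `N > 1`,
`Nb ≥ 3`), for the antiferromagnet `H = J Σ_{⟨xy⟩}(SˣSˣ + SʸSʸ + Δ SᶻSᶻ)` of spin `n/2` with
`J > 0`, `Δ > 0`, at inverse temperature `β ≥ 0`, under the smallness hypotheses of
`anisoAF_sigma_twoPoint_ge_half` at anisotropy `α = Δ⁻¹` and effective inverse temperature `βJΔ`
(window `t > 1`, `Δ' > 0`, `tΔ'b² ≤ n²/4`; `σ̄ = Δ⁻¹(n + tΔ')/((t-1)Δ') < 1`; `κ ≤ 1` and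
`κ^{(b-1)/b⁵} ≤ 10⁻¹⁰`, `κ = anisoAFKappa n b Δ⁻¹ t Δ' (βJΔ)`), the staggered sign observable
`N_x(σ)` (`= sgn⁺ S³_x` on the even and `sgn⁺(-S³_x)` on the odd sublattice: the Néel placement of
`σ = P⁺ - P⁻`, i.e. the sign of FL's order parameter `m_x = S⁻¹(-1)^{x₁+x₂}Sᶻ_x`) has
`Re⟨N_m(σ) N_{n'}(σ)⟩_β ≥ 1/2` for all sites `m ≠ n'` — FL (1.9) with `M² = 1/2`.
[cite: FrohlichLieb1978, §I.A (3), §I.B (3) and eq. (1.9), §IV (c)] -/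
theorem xxzAF_neelSigma_twoPoint_ge_half [NeZero (N * b)] (hN : Even N) (hN1 : 1 < N)
    (hL : 2 < N * b) {J Δ : ℝ} (hJ : 0 < J) (hΔ : 0 < Δ) {β : ℝ} (hβ : 0 ≤ β) {t Δ' : ℝ}
    (ht : 1 < t) (hΔ' : 0 < Δ') (hwin : t * Δ' * (b : ℝ) ^ 2 ≤ (n : ℝ) ^ 2 / 4)
    (hσ : Δ⁻¹ * (n + t * Δ') / ((t - 1) * Δ') < 1)
    (hκ1 : anisoAFKappa n b Δ⁻¹ t Δ' (β * (J * Δ)) ≤ 1)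
    (hθ : anisoAFKappa n b Δ⁻¹ t Δ' (β * (J * Δ)) ^ (((b - 1 : ℕ) : ℝ) / (b : ℝ) ^ (2 * 2 + 1)) ≤
      1 / 10 ^ 10)
    {m n' : TorusSite 2 (N * b)} (hmn : m ≠ n') :
    (1 : ℝ) / 2 ≤ (Matrix.gibbsState β (xxzHamiltonian n (torusGraph 2 (N * b)) J Δ)
        (onSite m (neelDiagonal (N * b) (hN.mul_right b)
            (fun k : Fin (n + 1) => if 2 * (k : ℕ) ≤ n then (1 : ℂ) else -1) m) *
          onSite n' (neelDiagonal (N * b) (hN.mul_right b)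
            (fun k : Fin (n + 1) => if 2 * (k : ℕ) ≤ n then (1 : ℂ) else -1) n'))).re := by
  rw [xxz_gibbsState_neel_twoPoint_eq (N * b) (hN.mul_right b) n hΔ.ne' β,
    ← szNonnegProj_sub_szNegProj]
  exact anisoAF_sigma_twoPoint_ge_half n hN hN1 hL (inv_nonneg.mpr hΔ.le)
    (mul_nonneg hβ (mul_pos hJ hΔ).le) ht hΔ' hwin hσ hκ1 hθ hmn

/-- **Explicit thresholds, physical frame** (`b = 2`, `t = 2`, `Δ' = n²/64`): on the torus
`(ℤ/2Nℤ)²` (`N` even, `N > 1`), for spin `n/2 ≥ 1/2`, Ising anisotropy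
`Δ ≥ (64 + 2n)/n · (2·10³²⁰)^{32/n}` and `βJΔ ≥ 16(log(2·10³²⁰) + 4 log(n+1))/n²` (a low-temperature
condition for the antiferromagnetic sign `J > 0`), the XXZ model `J Σ(SˣSˣ + SʸSʸ + Δ SᶻSᶻ)` has
`Re⟨N_m(σ) N_{n'}(σ)⟩_β ≥ 1/2` for all sites `m ≠ n'` (`N_x(σ)` the staggered sign observable).
[cite: FrohlichLieb1978, §I.A (3), §I.B (3), §IV (c), eqs. (4.5), (1.51)] -/
theorem xxzAF_neelSigma_twoPoint_ge_half_explicit [NeZero (N * 2)] (hn : 1 ≤ n) (hN : Even N)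
    (hN1 : 1 < N) {J Δ : ℝ} (hΔ : (64 + 2 * n) / (n : ℝ) * (2 * 10 ^ 320) ^ (32 / (n : ℝ)) ≤ Δ)
    {β : ℝ}
    (hβ : 16 * (Real.log (2 * 10 ^ 320) + 4 * Real.log ((n : ℝ) + 1)) / (n : ℝ) ^ 2 ≤
      β * (J * Δ))
    {m n' : TorusSite 2 (N * 2)} (hmn : m ≠ n') :
    (1 : ℝ) / 2 ≤ (Matrix.gibbsState β (xxzHamiltonian n (torusGraph 2 (N * 2)) J Δ)
        (onSite m (neelDiagonal (N * 2) (hN.mul_right 2)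
            (fun k : Fin (n + 1) => if 2 * (k : ℕ) ≤ n then (1 : ℂ) else -1) m) *
          onSite n' (neelDiagonal (N * 2) (hN.mul_right 2)
            (fun k : Fin (n + 1) => if 2 * (k : ℕ) ≤ n then (1 : ℂ) else -1) n'))).re := by
  have hn0 : (0 : ℝ) < n := by exact_mod_cast hn
  have hK : (0 : ℝ) < 2 * 10 ^ 320 := by positivity
  have hpos : 0 < (64 + 2 * n) / (n : ℝ) * (2 * 10 ^ 320) ^ (32 / (n : ℝ)) :=
    mul_pos (div_pos (by positivity) hn0) (Real.rpow_pos_of_pos hK _)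
  have hΔ0 : 0 < Δ := hpos.trans_le hΔ
  have hα : Δ⁻¹ ≤ (n : ℝ) / (64 + 2 * n) * (2 * 10 ^ 320) ^ (-(32 / (n : ℝ))) := by
    rw [Real.rpow_neg hK.le, ← inv_div ((64 : ℝ) + 2 * n) (n : ℝ), ← mul_inv]
    exact inv_anti₀ hpos hΔ
  rw [xxz_gibbsState_neel_twoPoint_eq (N * 2) (hN.mul_right 2) n hΔ0.ne' β,
    ← szNonnegProj_sub_szNegProj]
  exact anisoAF_sigma_twoPoint_ge_half_explicit n hn hN hN1 (inv_nonneg.mpr hΔ0.le) hα hβ hmn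

end PhysicalFrame

/-- **Fröhlich–Lieb's theorem for the quantum antiferromagnet (3), as printed** ("For each `S`
there is an `α(S)` and `β_c(α)` such that for `α < α(S)` and `β > β_c(α)` there is LRO. As
`S → ∞`, `α(S) → 1`"), in the physical frame of the tree's XXZ model: for every coupling `J > 0`
and every Ising anisotropy `Δ > 1` (`α = Δ⁻¹ < 1`) there is a spin `n₀/2` such that for every spin
`n/2 ≥ n₀/2` there is an inverse temperature `β₀` beyond which the antiferromagnet
`J Σ_{⟨xy⟩}(SˣSˣ + SʸSʸ + Δ SᶻSᶻ)` on every torus `(ℤ/2Nℤ)²` (`N` even, `N > 1`) has Néel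
long-range order in the sense of FL (1.9): `Re⟨N_m(σ) N_{n'}(σ)⟩_β ≥ 1/2` for all sites `m ≠ n'`,
`N_x(σ)` the sign of the staggered spin `(-1)^{x₁+x₂}S³_x` (`sgn⁺ 0 = +1`).
[cite: FrohlichLieb1978, §I.A (3), §I.B (3) and eq. (1.9), §IV (c)] -/
theorem xxzAF_longRangeOrder_of_one_lt {J Δ : ℝ} (hJ : 0 < J) (hΔ : 1 < Δ) :
    ∃ n₀ : ℕ, ∀ n : ℕ, n₀ ≤ n → ∃ β₀ : ℝ, ∀ β : ℝ, β₀ ≤ β →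
      ∀ {N : ℕ} [NeZero N] [NeZero (N * 2)] (hN : Even N), 1 < N →
        ∀ {m n' : TorusSite 2 (N * 2)}, m ≠ n' →
          (1 : ℝ) / 2 ≤ (Matrix.gibbsState β (xxzHamiltonian n (torusGraph 2 (N * 2)) J Δ)
            (onSite m (neelDiagonal (N * 2) (hN.mul_right 2)
                (fun k : Fin (n + 1) => if 2 * (k : ℕ) ≤ n then (1 : ℂ) else -1) m) *
              onSite n' (neelDiagonal (N * 2) (hN.mul_right 2)
                (fun k : Fin (n + 1) => if 2 * (k : ℕ) ≤ n then (1 : ℂ) else -1) n'))).re := by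
  have hΔ0 : 0 < Δ := zero_lt_one.trans hΔ
  have hJΔ : 0 < J * Δ := mul_pos hJ hΔ0
  obtain ⟨n₀, hn₀⟩ :=
    anisoAF_longRangeOrder_of_lt_one (inv_nonneg.mpr hΔ0.le) (inv_lt_one_of_one_lt₀ hΔ)
  refine ⟨n₀, fun n hn => ?_⟩
  obtain ⟨β₀, hβ₀⟩ := hn₀ n hn
  refine ⟨β₀ / (J * Δ), ?_⟩
  intro β hβ N _ _ hN hN1 m n' hmn
  rw [xxz_gibbsState_neel_twoPoint_eq (N * 2) (hN.mul_right 2) n hΔ0.ne' β,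
    ← szNonnegProj_sub_szNegProj]
  exact hβ₀ (β * (J * Δ)) ((div_le_iff₀ hJΔ).mp hβ) hN hN1 hmn

end Literature.MathematicalPhysics.QuantumLattice
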